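import Summits.CriticalPhenomena.CardyFormulaZ2.Theorems.CardyBondTriangularBondTriangularCardyCrudeRun

/-!
# Route CardyBondTriangular · crux `BondTriangularCardy` (stmt-CriticalPhenomena-4664), line `birth`,
# stub `stub_discreteDomains`, part (D2), lower inclusion: a yellow crossing of the longer–thinner
# domain is a crude open crossing of `Ω` for bond-`𝕋`, or a yellow corner arm

Helper of the stub `stub_discreteDomains` (`Sig.discreteDomains`, sandwich clause, lower half),
second file: the assembly, on top of the geometric lemmas and the run extraction of
`…CrudeRun.lean` (`frontier_near_far_hexagon`, `exit_near_far_hexagon`, `crude_of_walk`).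
Bollobás–Riordan, *Percolation* (CUP 2006), Ch. 7, Claim 19 (first part) and Claim 20, p. 192,
with the remark p. 195, for CRITICAL BOND PERCOLATION ON `𝕋` in its Chayes–Lei hexagon
representation (`clOfBond`, Chayes–Lei 2007 §2.1) and the crude crossing event
`embDomainCrossing` of the route (embedding `z x = √3 (triEmbed x - (1+ζ)/3)`, mesh `δ/√3`):

Let `G` be a 4-marked discrete domain placed in `δ𝕋` which is longer–thinner than the conformal
rectangle `R` at precision `t` and corner radius `ρ` (`TriMarkedDomain.IsLongerThinner`), and let
`Q` be a `𝕋`-walk of hexagons of `G`, none pure blue, consecutive ones sharing a yellow (half-)edge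
in the packaged configuration `clOfBond ω`, from a hexagon of the discrete arc `A₂(G)` to a hexagon
of `A₀(G)`. Then (`crude_or_cornerArm_of_yellowCrossing`), for `δ < δ₀(R, ρ)`, `t ≤ t₀(R, ρ)`:
EITHER `ω` has a crude open crossing of `Ω` at mesh `δ/√3` — an open bond path all of whose
vertices `y` have `δ (triEmbed y - (1+ζ)/3) ∈ Ω`, from a vertex within `2δ/√3` of `A₀` to a vertex
within `2δ/√3` of `A₂` — OR some hexagon of `Q` within `ρ` of a marked point of `R` is joined by a
yellow path to a hexagon farther than `r₂ = r₂(R)` from it (a yellow corner arm).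

Proof. If a hexagon of `Q` is within `ρ` of a corner, the walk `Q` itself is the arm (its far end
is near the opposite arc). Otherwise, by the bond dictionary (`openGraph_reachable_of_clYellowGraph_walk`
applied to the configuration restricted to the bonds of the triangles of `Q`) an active site of the
first hexagon is joined to an active site of the last one by an open path `W` all of whose bonds
are bonds of the up-triangles packaged into the hexagons of `Q`; at mesh `δ/√3` the vertices of the
bond lattice sit at `δ triEmbed y - δ(1+ζ)/3`, within `δ` of the centres `δ triEmbed x` of their
hexagons, and every bond of `W` lies in the closed `δ`-ball about the centre of its hexagon. The
frontier points of `Ω` in such a ball lie on `A₀ ∪ A₂` (`frontier_near_far_hexagon`: for a hexagon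
centre in `Ω` by `far_in`, off `Ω` by `far_out` and the corner modulus of `R`). A run extraction
along `W` (strong induction on the length, `crude_of_walk`): from a vertex on the `A₂`-side (off
`Ω` within `t + δ` of `A₂`, or in `Ω` within `δ` of `A₂`) the walk either stays in `Ω` up to its end
(in `Ω` within `δ` of `A₀`, or off `Ω` near `A₀`) or first leaves `Ω` across `A₀` — a crude crossing
— or across `A₂`, restarting the extraction on a shorter walk; `A₀`-near and `A₂`-near points are
never within `δ` of each other.

References: B. Bollobás, O. Riordan, *Percolation*, CUP 2006, Ch. 7, Claims 19–20 p. 192, remark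
p. 195; L. Chayes, H. K. Lei, Rev. Math. Phys. 19 (2007) §2.1.
-/

noncomputable section

namespace Summit.CriticalPhenomena.CardyFormulaZ2.Theorems.BondTriangularCardyLine

open Set Filter Topology Metric
open Literature.Probability.Percolation Literature.Probability.RandomPlanarGeometry
open Literature.Probability.RandomPlanarGeometry.MarkedDomain
open Literature.Probability.LatticeModels

/-! ### Yellow walks of hexagons join every hexagon to both ends -/

/-- A `𝕋`-walk all of whose darts are yellow adjacencies joins every site of its support to both
its ends in the yellow graph. -/
theorem clYellow_reachable_ends_of_darts {σ : CLHexConfig} {u v : Site 2} (P : triGraph.Walk u v)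
    (hdarts : ∀ d ∈ P.darts, (clYellowGraph σ).Adj d.fst d.snd) {x : Site 2} (hx : x ∈ P.support) :
    (clYellowGraph σ).Reachable x u ∧ (clYellowGraph σ).Reachable x v := by
  classical
  have hedges : ∀ e ∈ P.edges, e ∈ (clYellowGraph σ).edgeSet := by
    intro e he
    rw [SimpleGraph.Walk.edges, List.mem_map] at he
    obtain ⟨d, hd, rfl⟩ := he
    rw [show d.edge = s(d.fst, d.snd) from rfl, SimpleGraph.mem_edgeSet]
    exact hdarts d hd
  set Q := P.transfer (clYellowGraph σ) hedges with hQ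
  have hxQ : x ∈ Q.support := by rw [hQ, SimpleGraph.Walk.support_transfer]; exact hx
  exact ⟨⟨(Q.takeUntil x hxQ).reverse⟩, ⟨Q.dropUntil x hxQ⟩⟩

/-! ### The lower inclusion: a yellow crossing of the longer–thinner domain is a crude crossing or a corner arm -/

/-- **(D2, lower inclusion) A yellow crossing of a longer–thinner domain gives a crude open crossing
of `Ω` for bond-`𝕋`, or a yellow corner arm.** For every conformal rectangle `R` there is
`r₂ = r₂(R) > 0` such that for every corner radius `ρ ∈ (0, r₂]` there are `δ₀, t₀ > 0` with the
following property for `0 < δ < δ₀`, `0 ≤ t ≤ t₀`. Let `G` be a 4-marked discrete domain placed in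
`δ𝕋`, longer–thinner than `R` at `(t, ρ)`; let `ω ⊆ E(𝕋)` be a bond configuration and `Q` a
`𝕋`-walk of hexagons of `G`, none of them pure blue in the packaged configuration `clOfBond ω`,
consecutive ones sharing a yellow (half-)edge, from a hexagon of `A₂(G)` to a hexagon of `A₀(G)`.
Then either `ω` belongs to the crude crossing event
`embDomainCrossing (√3 (triEmbed · - (1+ζ)/3)) Ω (δ/√3) A₀ A₂` of the route (an open bond path with
all vertices in `Ω` at mesh `δ/√3`, from within `2δ/√3` of `A₀` to within `2δ/√3` of `A₂`), or some
hexagon of `Q` within `ρ` of a marked point `R.pt j` is joined by a yellow path to a hexagon farther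
than `r₂` from `R.pt j`. (Bollobás–Riordan 2006, Ch. 7, Claims 19–20 p. 192 and remark p. 195, for
bond-`𝕋`: the bond dictionary `openGraph_reachable_of_clYellowGraph_walk` of Chayes–Lei 2007 §2.1
on the configuration restricted to the bonds of the triangles of `Q`, and the run extraction
`crude_of_walk`.) -/
theorem crude_or_cornerArm_of_yellowCrossing :
    ∀ (R : Literature.Probability.RandomPlanarGeometry.ConformalRectangle), ∃ r₂ > (0 : ℝ), ∀ ρ : ℝ, 0 < ρ → ρ ≤ r₂ →
      ∃ δ₀ > (0 : ℝ), ∃ t₀ > (0 : ℝ), ∀ δ t : ℝ, 0 < δ → δ < δ₀ → 0 ≤ t → t ≤ t₀ →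
      ∀ (G : Literature.Probability.Percolation.TriMarkedDomain 4), G.IsLongerThinner R δ t ρ →
      ∀ (ω : Literature.Probability.Percolation.BondConfig (Literature.Probability.LatticeModels.Site 2)),
        ω ⊆ Literature.Probability.LatticeModels.triGraph.edgeSet →
      ∀ (a b : Literature.Probability.LatticeModels.Site 2) (Q : Literature.Probability.LatticeModels.triGraph.Walk a b),
        a ∈ G.arc 2 → b ∈ G.arc 0 →
        (∀ x ∈ Q.support, x ∈ G.verts ∧ Literature.Probability.Percolation.clOfBond ω x ≠ Literature.Probability.Percolation.CLHexState.B) →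
        (∀ d ∈ Q.darts, (Literature.Probability.Percolation.clYellowGraph (Literature.Probability.Percolation.clOfBond ω)).Adj d.fst d.snd) →
        ω ∈ Literature.Probability.Percolation.embDomainCrossing
            (fun x : Literature.Probability.LatticeModels.Site 2 ↦ (Real.sqrt 3 : ℂ) * (Literature.Probability.LatticeModels.triEmbed x - (1 + Literature.Probability.LatticeModels.triZeta) / 3))
            R.carrier (δ / Real.sqrt 3) (R.arc 0) (R.arc 2) ∨
          ∃ j : Fin 4, ∃ x y : Literature.Probability.LatticeModels.Site 2,
            (Literature.Probability.Percolation.clYellowGraph (Literature.Probability.Percolation.clOfBond ω)).Reachable x y ∧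
            ‖Literature.Probability.LatticeModels.triMeshPoint δ x - R.pt j‖ < ρ ∧ r₂ < ‖Literature.Probability.LatticeModels.triMeshPoint δ y - R.pt j‖ := by
  intro R
  classical
  obtain ⟨εR, hεR, hεd⟩ := R.exists_pos_forall_lt_dist_arc
  refine ⟨εR / 2, by positivity, fun ρ hρ _ => ?_⟩
  obtain ⟨ηc, hηc, hcm⟩ := R.exists_corner_modulus (half_pos hρ)
  refine ⟨min (εR / 8) (min (ηc / 4) (ρ / 8)), by positivity, min (εR / 8) (ηc / 4), by positivity, ?_⟩
  intro δ t hδ hδlt ht htle G hG ω hωE a b Q ha hb hsupp hdarts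
  have hδε : δ < εR / 8 := hδlt.trans_le (min_le_left _ _)
  have hδη : δ < ηc / 4 := hδlt.trans_le ((min_le_right _ _).trans (min_le_left _ _))
  have hδρ : δ < ρ / 8 := hδlt.trans_le ((min_le_right _ _).trans (min_le_right _ _))
  have htε : t ≤ εR / 8 := htle.trans (min_le_left _ _)
  have htη : t ≤ ηc / 4 := htle.trans (min_le_right _ _)
  have htη' : t + δ < ηc := by linarith
  have hδρ' : 2 * δ ≤ ρ := by linarith
  have hA0ne : (R.arc 0).Nonempty := ⟨_, R.pt_mem_arc_self 0⟩
  have hA2ne : (R.arc 2).Nonempty := ⟨_, R.pt_mem_arc_self 2⟩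
  -- the corner case: a hexagon of `Q` near a marked point gives the arm
  by_cases hcorner : ∃ x ∈ Q.support, ∃ j : Fin 4, dist (triMeshPoint δ x) (R.pt j) < ρ
  · obtain ⟨x, hx, j, hxj⟩ := hcorner
    right
    refine ⟨j, ?_⟩
    obtain ⟨hxa, hxb⟩ := clYellow_reachable_ends_of_darts Q hdarts hx
    rcases pt_mem_arc_zero_or_two R j with hj | hj
    · refine ⟨x, a, hxa, by rwa [← dist_eq_norm], ?_⟩
      rw [← dist_eq_norm]
      have := le_dist_of_infDist_le hA2ne (fun b' hb' => hεd (R.pt j) hj b' hb') (hG.arc_two a ha).1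
      linarith
    · refine ⟨x, b, hxb, by rwa [← dist_eq_norm], ?_⟩
      rw [← dist_eq_norm]
      have := le_dist_of_infDist_le hA0ne (fun a' ha' => by rw [dist_comm]; exact hεd a' ha' (R.pt j) hj)
        (hG.arc_zero b hb).1
      linarith
  -- the far case: all hexagons of `Q` are at distance `≥ ρ` from the marked points
  push Not at hcorner
  left
  have ha' := hG.arc_two a ha
  have hb' := hG.arc_zero b hb
  have haΩ : triMeshPoint δ a ∉ R.carrier := ha'.2 (hcorner a (SimpleGraph.Walk.start_mem_support _))
  have hbΩ : triMeshPoint δ b ∉ R.carrier := hb'.2 (hcorner b (SimpleGraph.Walk.end_mem_support _))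
  -- the configuration restricted to the bonds of the triangles of `Q`
  set QB : Set (Sym2 (Site 2)) := {e | ∃ x ∈ Q.support, ∃ j : Fin 3, e = triBond x j} with hQB
  set ω' : BondConfig (Site 2) := ω ∩ QB with hω'
  have hωω' : ∀ x ∈ Q.support, ∀ j : Fin 3, triBond x j ∈ ω' ↔ triBond x j ∈ ω :=
    fun x hx j => ⟨fun h => h.1, fun h => ⟨h, x, hx, j, rfl⟩⟩
  -- `Q` is a yellow walk for `clOfBond ω'` as well
  have hdarts' : ∀ d ∈ Q.darts, (clYellowGraph (clOfBond ω')).Adj d.fst d.snd := by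
    intro d hd
    obtain ⟨hadj, v, ⟨j, hj, hvj⟩, ⟨j', hj', hvj'⟩⟩ := (clYellowGraph_clOfBond_adj_iff ω _ _).1 (hdarts d hd)
    rw [clYellowGraph_clOfBond_adj_iff]
    exact ⟨hadj, v, ⟨j, (hωω' _ (Q.dart_fst_mem_support_of_mem_darts hd) j).2 hj, hvj⟩,
      ⟨j', (hωω' _ (Q.dart_snd_mem_support_of_mem_darts hd) j').2 hj', hvj'⟩⟩
  have hedges : ∀ e ∈ Q.edges, e ∈ (clYellowGraph (clOfBond ω')).edgeSet := by
    intro e he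
    rw [SimpleGraph.Walk.edges, List.mem_map] at he
    obtain ⟨d, hd, rfl⟩ := he
    rw [show d.edge = s(d.fst, d.snd) from rfl, SimpleGraph.mem_edgeSet]
    exact hdarts' d hd
  set Qy := Q.transfer (clYellowGraph (clOfBond ω')) hedges with hQy
  -- active sites of the end hexagons (they are not pure blue)
  have hsucc : ∀ j : Fin 3, j + 1 ≠ j := by decide
  obtain ⟨ja, hja⟩ : ∃ j, triBond a j ∈ ω := by
    have h := (hsupp a (SimpleGraph.Walk.start_mem_support _)).2
    rw [Ne, clOfBond_eq_B_iff] at h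
    push Not at h
    exact h
  obtain ⟨jb, hjb⟩ : ∃ j, triBond b j ∈ ω := by
    have h := (hsupp b (SimpleGraph.Walk.end_mem_support _)).2
    rw [Ne, clOfBond_eq_B_iff] at h
    push Not at h
    exact h
  set u : Site 2 := faceVertex (a, 0) (ja + 1) with hu_def
  set v : Site 2 := faceVertex (b, 0) (jb + 1) with hv_def
  have hua : u ∈ hexFaceVertices (a, 0) := faceVertex_mem _ _
  have hvb : v ∈ hexFaceVertices (b, 0) := faceVertex_mem _ _
  have hu : IsActiveSite ω' a u :=
    ⟨ja, (hωω' a (SimpleGraph.Walk.start_mem_support _) ja).2 hja, (faceVertex_mem_triBond_iff a ja (ja + 1)).2 (hsucc ja)⟩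
  have hv : IsActiveSite ω' b v :=
    ⟨jb, (hωω' b (SimpleGraph.Walk.end_mem_support _) jb).2 hjb, (faceVertex_mem_triBond_iff b jb (jb + 1)).2 (hsucc jb)⟩
  obtain ⟨Wb⟩ := openGraph_reachable_of_clYellowGraph_walk Qy hu hv
  -- the bonds of `Wb` are bonds of the triangles of the (far) hexagons of `Q`
  have hbond : ∀ y y', (openGraph ω').Adj y y' →
      s(y, y') ∈ ω ∧ triGraph.Adj y y' ∧ ∃ x ∈ Q.support, y ∈ hexFaceVertices (x, 0) ∧ y' ∈ hexFaceVertices (x, 0) := by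
    intro y y' h
    obtain ⟨hmem, -⟩ := (openGraph_adj ω' y y').1 h
    obtain ⟨hω, x, hx, j, hj⟩ := hmem
    have hy : y ∈ triBond x j := by rw [← hj]; exact Sym2.mem_mk_left _ _
    have hy' : y' ∈ triBond x j := by rw [← hj]; exact Sym2.mem_mk_right _ _
    obtain ⟨k, -, rfl⟩ := exists_eq_faceVertex_of_mem_triBond hy
    obtain ⟨k', -, rfl⟩ := exists_eq_faceVertex_of_mem_triBond hy'
    exact ⟨hω, (SimpleGraph.mem_edgeSet triGraph).1 (hωE hω), x, hx, faceVertex_mem _ _, faceVertex_mem _ _⟩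
  -- positions of the bond-lattice vertices at mesh `δ/√3`
  set q : Site 2 → ℂ := fun y => (δ : ℂ) * (triEmbed y - (1 + triZeta) / 3) with hq
  set T : ℝ := t + δ with hT
  have hδT : δ ≤ T := by rw [hT]; linarith
  -- no point is within `T + δ` of both `A₀` and `A₂`, even up to a `δ`-step
  have hsep : ∀ z z' : ℂ, dist z z' ≤ δ → infDist z (R.arc 0) ≤ T → infDist z' (R.arc 2) ≤ T → False := by
    intro z z' hzz' hz hz'
    obtain ⟨a₀, ha₀, hda₀⟩ := (infDist_lt_iff hA0ne).1 (lt_of_le_of_lt hz (lt_add_of_pos_right T hδ))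
    obtain ⟨a₂, ha₂, hda₂⟩ := (infDist_lt_iff hA2ne).1 (lt_of_le_of_lt hz' (lt_add_of_pos_right T hδ))
    have h1 := hεd a₀ ha₀ a₂ ha₂
    have h2 := dist_triangle4 a₀ z z' a₂
    rw [dist_comm a₀ z] at h2
    rw [hT] at hda₀ hda₂
    linarith
  -- the hypotheses of the run extraction for `H = openGraph ω'`
  have hstep : ∀ y y', (openGraph ω').Adj y y' → dist (q y) (q y') ≤ δ := fun y y' h =>
    (dist_bondVertex_of_adj (hbond y y' h).2.1 hδ).le
  have hexit : ∀ y y', (openGraph ω').Adj y y' → q y ∈ R.carrier → q y' ∉ R.carrier →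
      ∃ w, (w ∈ R.arc 0 ∨ w ∈ R.arc 2) ∧ dist (q y) w ≤ δ ∧ dist (q y') w ≤ δ := by
    intro y y' h hyΩ hy'Ω
    obtain ⟨-, hadj, x, hx, hyx, hy'x⟩ := hbond y y' h
    obtain ⟨w, hw, hd1, hd2⟩ := exit_near_far_hexagon R hG hcm htη' hδρ' (hsupp x hx).1 (hcorner x hx)
      (dist_bondVertex_center_le hyx hδ) (dist_bondVertex_center_le hy'x hδ) hyΩ hy'Ω
    have hdd : dist (q y) (q y') = δ := dist_bondVertex_of_adj hadj hδ
    exact ⟨w, hw, hd1.trans hdd.le, hd2.trans hdd.le⟩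
  have hoff : ∀ y y', (openGraph ω').Adj y y' → q y' ∉ R.carrier →
      infDist (q y') (R.arc 0) ≤ T ∨ infDist (q y') (R.arc 2) ≤ T := by
    intro y y' h hy'Ω
    obtain ⟨-, -, x, hx, -, hy'x⟩ := hbond y y' h
    have hdy' := dist_bondVertex_center_le hy'x hδ
    by_cases hxΩ : triMeshPoint δ x ∈ R.carrier
    · obtain ⟨w, hw, -, hd2⟩ := exit_near_far_hexagon R hG hcm htη' hδρ' (hsupp x hx).1 (hcorner x hx)
        (z := triMeshPoint δ x) (z' := q y') (by rw [dist_self]; exact hδ.le) hdy' hxΩ hy'Ω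
      rw [dist_comm] at hdy'
      rcases hw with hw | hw
      · exact Or.inl (((infDist_le_dist_of_mem hw).trans hd2).trans (hdy'.trans hδT))
      · exact Or.inr (((infDist_le_dist_of_mem hw).trans hd2).trans (hdy'.trans hδT))
    · rcases hG.far_out x (hsupp x hx).1 (hcorner x hx) hxΩ with h0 | h2
      · left
        have := infDist_le_infDist_add_dist (s := R.arc 0) (x := q y') (y := triMeshPoint δ x)
        rw [hT]; linarith
      · right
        have := infDist_le_infDist_add_dist (s := R.arc 2) (x := q y') (y := triMeshPoint δ x)
        rw [hT]; linarith
  -- the start `u` is on the `A₂`-side, the end `v` on the `A₀`-side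
  have hstart : (q u ∉ R.carrier ∧ infDist (q u) (R.arc 2) ≤ T) ∨ (q u ∈ R.carrier ∧ infDist (q u) (R.arc 2) ≤ δ) := by
    have hdu := dist_bondVertex_center_le hua hδ
    by_cases huΩ : q u ∈ R.carrier
    · right
      refine ⟨huΩ, ?_⟩
      obtain ⟨w, hw, hd1, hd2⟩ := exit_near_far_hexagon R hG hcm htη' hδρ' (hsupp a (SimpleGraph.Walk.start_mem_support _)).1
        (hcorner a (SimpleGraph.Walk.start_mem_support _)) (z := q u) (z' := triMeshPoint δ a)
        hdu (by rw [dist_self]; exact hδ.le) huΩ haΩ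
      rcases hw with hw | hw
      · exact (hsep (triMeshPoint δ a) (triMeshPoint δ a) (by rw [dist_self]; exact hδ.le)
          (((infDist_le_dist_of_mem hw).trans hd2).trans (hdu.trans hδT) |>.trans le_rfl) (ha'.1.trans (by rw [hT]; linarith))).elim
      · exact ((infDist_le_dist_of_mem hw).trans hd1).trans hdu
    · left
      refine ⟨huΩ, ?_⟩
      have := infDist_le_infDist_add_dist (s := R.arc 2) (x := q u) (y := triMeshPoint δ a)
      rw [hT]; linarith [ha'.1]
  have hend : (q v ∉ R.carrier ∧ infDist (q v) (R.arc 0) ≤ T) ∨ (q v ∈ R.carrier ∧ infDist (q v) (R.arc 0) ≤ δ) := by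
    have hdv := dist_bondVertex_center_le hvb hδ
    by_cases hvΩ : q v ∈ R.carrier
    · right
      refine ⟨hvΩ, ?_⟩
      obtain ⟨w, hw, hd1, hd2⟩ := exit_near_far_hexagon R hG hcm htη' hδρ' (hsupp b (SimpleGraph.Walk.end_mem_support _)).1
        (hcorner b (SimpleGraph.Walk.end_mem_support _)) (z := q v) (z' := triMeshPoint δ b)
        hdv (by rw [dist_self]; exact hδ.le) hvΩ hbΩ
      rcases hw with hw | hw
      · exact ((infDist_le_dist_of_mem hw).trans hd1).trans hdv
      · exact (hsep (triMeshPoint δ b) (triMeshPoint δ b) (by rw [dist_self]; exact hδ.le)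
          (hb'.1.trans (by rw [hT]; linarith)) (((infDist_le_dist_of_mem hw).trans hd2).trans (hdv.trans hδT))).elim
    · left
      refine ⟨hvΩ, ?_⟩
      have := infDist_le_infDist_add_dist (s := R.arc 0) (x := q v) (y := triMeshPoint δ b)
      rw [hT]; linarith [hb'.1]
  -- the run extraction
  obtain ⟨u', v', W', hu', hv', hin, hed⟩ :=
    crude_of_walk R δ T hδ hδT (openGraph ω') q hstep hexit hoff hsep Wb.length u v Wb le_rfl hstart hend
  -- the crude crossing event
  rw [mem_embDomainCrossing_iff]
  have hscale : ∀ y : Site 2, ((δ / Real.sqrt 3 : ℝ) : ℂ) * ((Real.sqrt 3 : ℂ) * (triEmbed y - (1 + triZeta) / 3)) = q y :=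
    fun y => embScale_mul_zT δ y
  have hslack : δ ≤ 2 * (δ / Real.sqrt 3) := le_two_mul_div_sqrt_three hδ.le
  refine ⟨u', by rw [hscale]; exact hu'.trans hslack, v', by rw [hscale]; exact hv'.trans hslack, ?_⟩
  have hS : {y : Site 2 | ((δ / Real.sqrt 3 : ℝ) : ℂ) * ((Real.sqrt 3 : ℂ) * (triEmbed y - (1 + triZeta) / 3)) ∈ R.carrier} =
      {y | q y ∈ R.carrier} := by
    ext y; simp only [mem_setOf_eq, hscale]
  rw [hS]
  refine mem_openConnIn_of_walk (G := openGraph ω') W'.reverse (fun z hz => ?_) (fun e he => ?_)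
  · rw [SimpleGraph.Walk.support_reverse, List.mem_reverse] at hz
    exact hin z hz
  · rw [SimpleGraph.Walk.edges_reverse, List.mem_reverse] at he
    have h1 : e ∈ (openGraph ω').edgeSet := Wb.edges_subset_edgeSet (hed e he)
    rw [openGraph, SimpleGraph.edgeSet_fromEdgeSet] at h1
    exact h1.1.1

end Summit.CriticalPhenomena.CardyFormulaZ2.Theorems.BondTriangularCardyLine

end
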